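import Summits.KontsevichZagierPeriods.KontsevichZagierPeriods.Theses.IsogenyCertificates
import Summits.KontsevichZagierPeriods.KontsevichZagierPeriods.Theorems.IsogenyCertificatesXMapPeriodTransferStubCellMonotone

/-!
# `AlgebraicModuliRealPeriodCell` (stmt-KontsevichZagierPeriods-18265, route IsogenyCertificates) —
line `Sketch`, stub T (`stub_algXMapTransfer`), phase 1a (ii): cell structure and monotonicity (E1)

Port of the `ℚ`-line's stub file `IsogenyCertificatesXMapPeriodTransferStubCellMonotone.lean`
(crux `XMapPeriodTransfer`, line `saturated-sign-cells`) to REAL data: for a real datum `(f, g, c)`,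
`f g : ℝ[X]`, `c : ℝ`, between `y² = P(x) = x³ + αx + β` and `y² = P'(x) = x³ + α'x + β'`
(`α β α' β' : ℝ`; Wronskian `W = f'g − fg' ≠ 0`, certificate identity
`c²·g·(f³ + α'fg² + β'g³) = P·W²`), on every CELL, i.e. every connected component `K` of the cell
locus `L = {P > 0, W ≠ 0} ⊆ ℝ`:

* the x-map `R = f/g` has no pole (`g ≠ 0`: evaluate the identity),
* `P'(R) = P·W²/(c²g⁴) > 0`,
* `R' = W/g²` (quotient rule), of constant sign on `K` (IVT), so `R` is strictly (anti)monotone,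
* `K = (p, ∞)` or `K = (p, q)` with `P·W = 0` at the finite ends.

No algebraicity is needed here (pure real analysis); the generic interval lemma
`cellMonotone_component_shape` is imported from the `ℚ`-line, not re-declared. Statements are the
`ℚ` ones with `(A : ℝ) ↦ α`, `aeval y f ↦ f.eval y`, hypothesis order unchanged.

References: M. Kontsevich, D. Zagier, *Periods* (2001), §1.2 (rule (2), change of variables);
L. C. Washington, *Elliptic Curves* (2008), §2.9.
-/

noncomputable section

open Set Filter MeasureTheory Polynomial Topology
open Literature.NumberTheory.Transcendental
open Summit.KontsevichZagierPeriods.IsogenyCertificates.XMapPeriodTransferCells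
  (cellMonotone_component_shape)

namespace Summit.KontsevichZagierPeriods.IsogenyCertificates.AlgRealPeriodCell.TransferCellMonotone

/-! ### Pointwise consequences of the certificate identity -/

/-- A real datum has `c ≠ 0` (`c = 0` gives `P·W² = 0` in the domain `ℝ[X]`, `P` monic). [folklore] -/
private theorem c_ne_zero {α β α' β' : ℝ} {f g : ℝ[X]} {c : ℝ}
    (hW : derivative f * g - f * derivative g ≠ 0)
    (hI : C (c ^ 2) * g * (f ^ 3 + C α' * f * g ^ 2 + C β' * g ^ 3) =
        (X ^ 3 + C α * X + C β) * (derivative f * g - f * derivative g) ^ 2) : c ≠ 0 := by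
  rintro rfl
  have hm : (X ^ 3 + (C α * X + C β) : ℝ[X]).Monic :=
    monic_X_pow_add (degree_linear_le.trans_lt (by norm_num))
  rw [← add_assoc] at hm
  simp only [ne_eq, OfNat.ofNat_ne_zero, not_false_eq_true, zero_pow, map_zero, zero_mul] at hI
  exact (mul_ne_zero hm.ne_zero (pow_ne_zero 2 hW)) hI.symm

/-- No pole on the cell locus: if `P(x) > 0` and `W(x) ≠ 0` then `g(x) ≠ 0` (evaluate the
certificate identity at `x`: the left side would vanish, the right side is `P(x)·W(x)² ≠ 0`).
[folklore] -/
theorem cellMonotone_noPole {α β α' β' : ℝ} {f g : ℝ[X]} {c : ℝ}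
    (hI : C (c ^ 2) * g * (f ^ 3 + C α' * f * g ^ 2 + C β' * g ^ 3) =
      (X ^ 3 + C α * X + C β) * (derivative f * g - f * derivative g) ^ 2)
    {x : ℝ} (hP : 0 < x ^ 3 + α * x + β)
    (hW : (derivative f * g - f * derivative g).eval x ≠ 0) : g.eval x ≠ 0 := by
  intro hg
  have hid := congrArg (fun p : ℝ[X] => p.eval x) hI
  simp only [eval_mul, eval_add, eval_pow, eval_C, eval_X, hg, mul_zero, zero_mul] at hid
  have hx : (x ^ 3 + α * x + β) * ((derivative f * g - f * derivative g).eval x) ^ 2 ≠ 0 := by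
    have := pow_ne_zero 2 hW
    positivity
  exact hx hid.symm

/-- Positivity of the target cubic along the x-map: `P'(R(x)) = P(x)·W(x)²/(c²·g(x)⁴) > 0` on
the cell locus. [folklore] -/
theorem cellMonotone_targetPos {α β α' β' : ℝ} {f g : ℝ[X]} {c : ℝ} (hc : c ≠ 0)
    (hI : C (c ^ 2) * g * (f ^ 3 + C α' * f * g ^ 2 + C β' * g ^ 3) =
      (X ^ 3 + C α * X + C β) * (derivative f * g - f * derivative g) ^ 2)
    {x : ℝ} (hP : 0 < x ^ 3 + α * x + β)
    (hW : (derivative f * g - f * derivative g).eval x ≠ 0) (hg : g.eval x ≠ 0) :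
    0 < (f.eval x / g.eval x) ^ 3 + α' * (f.eval x / g.eval x) + β' := by
  have hid := congrArg (fun p : ℝ[X] => p.eval x) hI
  simp only [eval_mul, eval_add, eval_pow, eval_C, eval_X] at hid
  have hpos : 0 < (x ^ 3 + α * x + β) * ((derivative f * g - f * derivative g).eval x) ^ 2 := by
    have := pow_ne_zero 2 hW
    positivity
  have key : (f.eval x / g.eval x) ^ 3 + α' * (f.eval x / g.eval x) + β' =
      (x ^ 3 + α * x + β) * ((derivative f * g - f * derivative g).eval x) ^ 2 /
        (c ^ 2 * (g.eval x) ^ 4) := by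
    rw [← hid]
    field_simp
  rw [key]
  positivity

/-- Quotient rule for the x-map: `R' = (f'g − fg')/g² = W/g²` wherever `g ≠ 0`. [folklore] -/
theorem cellMonotone_hasDerivAt (f g : ℝ[X]) {x : ℝ} (hg : g.eval x ≠ 0) :
    HasDerivAt (fun y : ℝ => f.eval y / g.eval y)
      ((derivative f * g - f * derivative g).eval x / (g.eval x) ^ 2) x := by
  have e : (derivative f * g - f * derivative g).eval x =
      (derivative f).eval x * g.eval x - f.eval x * (derivative g).eval x := by
    simp only [eval_sub, eval_mul]
  rw [e]
  exact (f.hasDerivAt x).div (g.hasDerivAt x) hg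

/-! ### The stub -/

/-- `P ≤ 0` far to the left: the cell locus is bounded below by `-(1 + |α| + |β|)`. [folklore] -/
theorem cellMonotone_lowerBound (α β : ℝ) {y : ℝ} (hy : 0 < y ^ 3 + α * y + β) :
    -(1 + |α| + |β|) ≤ y := by
  -- adapted from `XMapPeriodTransferCells.cellMonotone_lowerBound`, casts deleted
  refine not_lt.mp fun h => ?_
  have hA : -|α| ≤ α := neg_abs_le _
  have hB : β ≤ |β| := le_abs_self _
  have h0A : 0 ≤ |α| := abs_nonneg _
  have h0B : 0 ≤ |β| := abs_nonneg _
  obtain ⟨z, rfl⟩ : ∃ z : ℝ, y = -z := ⟨-y, (neg_neg y).symm⟩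
  have hz : 1 + |α| + |β| ≤ z := by linarith
  have hz1 : 1 ≤ z := by linarith
  have hz0 : 0 ≤ z := by linarith
  nlinarith [mul_le_mul_of_nonneg_left hA hz0, sq_nonneg z, mul_le_mul_of_nonneg_left hz1 hz0,
    mul_le_mul_of_nonneg_left hz hz0, mul_nonneg hz0 h0B]

/-- At a finite end `z ∉ L` of a cell lying in the closure of the cell, `P(z)·W(z) = 0`.
[folklore] -/
theorem cellMonotone_end_eq_zero (α β : ℝ) (f g : ℝ[X]) {K : Set ℝ} {z : ℝ}
    (hK : K ⊆ {y : ℝ | 0 < y ^ 3 + α * y + β ∧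
      (derivative f * g - f * derivative g).eval y ≠ 0})
    (hz : z ∉ {y : ℝ | 0 < y ^ 3 + α * y + β ∧
      (derivative f * g - f * derivative g).eval y ≠ 0})
    (hzK : z ∈ closure K) :
    (z ^ 3 + α * z + β) * (derivative f * g - f * derivative g).eval z = 0 := by
  have hP0 : 0 ≤ z ^ 3 + α * z + β := by
    have hsub : K ⊆ {y : ℝ | (fun _ => (0 : ℝ)) y < y ^ 3 + α * y + β} :=
      fun y hy => (hK hy).1
    have h := (closure_mono hsub).trans (closure_lt_subset_le continuous_const (by fun_prop)) hzK
    exact h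
  simp only [mem_setOf_eq, not_and, not_not] at hz
  rcases hP0.lt_or_eq with h | h
  · rw [hz h, mul_zero]
  · rw [← h, zero_mul]

/-- **Port of the registered stub `stub_cellMonotone`** (E1, cell structure and monotonicity) to
real data. On a cell `C` (the connected component of `x₀` in the cell locus `L`): `g ≠ 0`,
`P'(R) > 0`, `R` is differentiable with `R' = W/g²`, `R` is strictly monotone or antitone on `C`,
and `C = (p, ∞)` or `C = (p, q)` with `P·W = 0` at the finite ends. [cite: KontsevichZagier2001, §1.2] -/
theorem stub_cellMonotone : ∀ (α β α' β' : ℝ) (f g : Polynomial ℝ) (c : ℝ), Polynomial.derivative f * g - f * Polynomial.derivative g ≠ 0 → Polynomial.C (c ^ 2) * g * (f ^ 3 + Polynomial.C α' * f * g ^ 2 + Polynomial.C β' * g ^ 3) = (Polynomial.X ^ 3 + Polynomial.C α * Polynomial.X + Polynomial.C β) * (Polynomial.derivative f * g - f * Polynomial.derivative g) ^ 2 → ∀ (R W : ℝ → ℝ) (L : Set ℝ), R = (fun y => f.eval y / g.eval y) → W = (fun y => (Polynomial.derivative f * g - f * Polynomial.derivative g).eval y) → L = {y : ℝ | 0 <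 y ^ 3 + α * y + β ∧ W y ≠ 0} → ∀ x₀ ∈ L, (∀ x ∈ connectedComponentIn L x₀, g.eval x ≠ 0 ∧ 0 < R x ^ 3 + α' * R x + β' ∧ HasDerivAt R (W x / (g.eval x) ^ 2) x) ∧ (StrictMonoOn R (connectedComponentIn L x₀) ∨ StrictAntiOn R (connectedComponentIn L x₀)) ∧ ∃ p : ℝ, p < x₀ ∧ (p ^ 3 + α * p + β) * W p = 0 ∧ (connectedComponentIn L x₀ = Set.Ioi p ∨ ∃ q : ℝ, x₀ < q ∧ (q ^ 3 + α * q + β) * W q = 0 ∧ connectedComponentIn L x₀ = Set.Ioo p q) := by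
  intro α β α' β' f g c hWne hI R W L hR hW hL x₀ hx₀
  have hc := c_ne_zero hWne hI
  subst hR hW hL
  set L := {y : ℝ | 0 < y ^ 3 + α * y + β ∧
    (fun y : ℝ => (derivative f * g - f * derivative g).eval y) y ≠ 0} with hL
  set K := connectedComponentIn L x₀ with hK
  have hPcont : Continuous fun y : ℝ => y ^ 3 + α * y + β := by fun_prop
  have hWcont : Continuous fun y : ℝ => (derivative f * g - f * derivative g).eval y :=
    Polynomial.continuous _
  have hLo : IsOpen L :=
    (isOpen_lt continuous_const hPcont).and (isOpen_ne_fun hWcont continuous_const)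
  have hKL : K ⊆ L := connectedComponentIn_subset _ _
  have hx₀K : x₀ ∈ K := mem_connectedComponentIn hx₀
  -- (1) local facts on the cell
  have hloc : ∀ x ∈ K, g.eval x ≠ 0 ∧
      0 < (f.eval x / g.eval x) ^ 3 + α' * (f.eval x / g.eval x) + β' ∧
      HasDerivAt (fun y : ℝ => f.eval y / g.eval y)
        ((derivative f * g - f * derivative g).eval x / (g.eval x) ^ 2) x := by
    intro x hx
    have hg : g.eval x ≠ 0 := cellMonotone_noPole hI (hKL hx).1 (hKL hx).2
    exact ⟨hg, cellMonotone_targetPos hc hI (hKL hx).1 (hKL hx).2 hg,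
      cellMonotone_hasDerivAt f g hg⟩
  refine ⟨hloc, ?_, ?_⟩
  · -- (2) strict (anti)monotonicity: `R' = W/g²` has the constant sign of `W` on `K`
    have hKpre : IsPreconnected K := isPreconnected_connectedComponentIn
    have hconv : Convex ℝ K := (Real.convex_iff_isPreconnected).mpr hKpre
    have hRcont : ContinuousOn (fun y : ℝ => f.eval y / g.eval y) K := fun x hx =>
      (hloc x hx).2.2.continuousAt.continuousWithinAt
    have hint : interior K = K := (hLo.connectedComponentIn).interior_eq
    have hW₀ : (derivative f * g - f * derivative g).eval x₀ ≠ 0 := hx₀.2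
    rcases lt_or_gt_of_ne hW₀ with h0 | h0
    · right
      refine strictAntiOn_of_deriv_neg hconv hRcont fun x hx => ?_
      rw [hint] at hx
      rw [(hloc x hx).2.2.deriv]
      have hg := (hloc x hx).1
      have hWx : (derivative f * g - f * derivative g).eval x < 0 := by
        refine lt_of_not_ge fun hcon => ?_
        obtain ⟨z, hzK, hz⟩ :=
          hKpre.intermediate_value hx₀K hx hWcont.continuousOn ⟨h0.le, hcon⟩
        exact (hKL hzK).2 hz
      exact div_neg_of_neg_of_pos hWx (by positivity)
    · left
      refine strictMonoOn_of_deriv_pos hconv hRcont fun x hx => ?_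
      rw [hint] at hx
      rw [(hloc x hx).2.2.deriv]
      have hg := (hloc x hx).1
      have hWx : 0 < (derivative f * g - f * derivative g).eval x := by
        refine lt_of_not_ge fun hcon => ?_
        obtain ⟨z, hzK, hz⟩ :=
          hKpre.intermediate_value hx hx₀K hWcont.continuousOn ⟨hcon, h0.le⟩
        exact (hKL hzK).2 hz
      positivity
  · -- (3) the shape of the cell
    obtain ⟨p, hpx₀, hpL, hshape⟩ := cellMonotone_component_shape hLo
      (fun y hy => cellMonotone_lowerBound α β hy.1) hx₀
    refine ⟨p, hpx₀, cellMonotone_end_eq_zero α β f g hKL hpL ?_, ?_⟩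
    · rcases hshape with h | ⟨q, hx₀q, -, h⟩
      · rw [hK, h, closure_Ioi]; exact self_mem_Ici
      · rw [hK, h, closure_Ioo (hpx₀.trans hx₀q).ne]
        exact left_mem_Icc.mpr (hpx₀.trans hx₀q).le
    · rcases hshape with h | ⟨q, hx₀q, hqL, h⟩
      · exact Or.inl h
      · refine Or.inr ⟨q, hx₀q, cellMonotone_end_eq_zero α β f g hKL hqL ?_, h⟩
        rw [hK, h, closure_Ioo (hpx₀.trans hx₀q).ne]
        exact right_mem_Icc.mpr (hpx₀.trans hx₀q).le

end Summit.KontsevichZagierPeriods.IsogenyCertificates.AlgRealPeriodCell.TransferCellMonotone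

end
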